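import Mathlib.AlgebraicGeometry.Morphisms.Affine
import Mathlib.AlgebraicGeometry.Pullbacks
import Mathlib.Algebra.Category.Ring.Constructions
import HarnessLib

/-!
# Affine charts of a base change: `Γ(pr⁻¹V₀, 𝒪) = Γ(V₀, 𝒪) ⊗_{Γ(S)} Γ(S')`

For a morphism `q : P → S` to an AFFINE scheme `S`, a morphism `s : S' → S` from an AFFINE `S'`, the
base change `X'' := P ×_S S'` with projections `pr : X'' → P`, `f' : X'' → S'`, and an affine open
`V₀ ⊆ P`: **`pr⁻¹V₀` is affine and its coordinate ring is the pushout (tensor product)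
`Γ(V₀, 𝒪_P) ⊗_{Γ(S, 𝒪)} Γ(S', 𝒪)`**, the structure maps being `pr♯ : Γ(V₀) → Γ(pr⁻¹V₀)` and
`f'♯ : Γ(S') → Γ(pr⁻¹V₀)` (Stacks 01JO–01JS: fibre products of affines are `Spec` of tensor
products; Mathlib `isPushout_appTop_of_isPullback`). We also record the purely algebraic
consequence used for adic base changes `S' = Spec B̂ → S = Spec B` (Stacks 088B): **if
`Γ(S)/r ≅ Γ(S')/r` then `Γ(V₀)/r ≅ Γ(pr⁻¹V₀)/r`** (`quotient_bijective_of_isPushout`).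

* `isAffineOpen_preimage_pullback_fst_of_isAffine` — `pr⁻¹V₀` is affine;
* `isPushout_chart` — `IsPushout (q♯ : Γ(S) → Γ(V₀)) (s♯) (pr♯ : Γ(V₀) → Γ(pr⁻¹V₀)) (f'♯)`;
* `isPushout_restrict` — the case `P = S`, `q = 𝟙`: `Γ(s⁻¹V₀) = Γ(V₀) ⊗_{Γ(S)} Γ(S')` for affine
  `V₀ ⊆ S`;
* `quotient_bijective_of_isPushout` — algebra: for a pushout square of commutative rings
  `R → C, R → T, C → C'', T → C''` and `r ∈ R` with `R/r → T/rT` bijective, `C/rC → C''/rC''` is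
  bijective.

Everything is proved; no named facts.

## References

* The Stacks Project, Tags 01JO–01JS (fibre products of schemes), Tag 088B. [StacksProject]
* U. Görtz, T. Wedhorn, *Algebraic Geometry I*, 2nd ed. (2020), Thm. 4.18, Prop. 4.20. [GortzWedhorn2020]
-/

noncomputable section

-- `TopCat.Presheaf` is not reducible (as in Mathlib's `AlgebraicGeometry/Modules`).
set_option backward.isDefEq.respectTransparency false

open CategoryTheory AlgebraicGeometry Limits TopologicalSpace Opposite TensorProduct

universe u

namespace Literature.AlgebraicGeometry.Morphisms

/-! ### Algebra: quotients modulo `r` along a pushout square -/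

section Algebra

variable {R C T C'' : Type u} [CommRing R] [CommRing C] [CommRing T] [CommRing C'']
  [Algebra R C] [Algebra R T] [Algebra R C''] [Algebra C C''] [Algebra T C'']
  [IsScalarTower R C C''] [IsScalarTower R T C''] [Algebra.IsPushout R C T C'']

/-- `span {r} ≤ comap φ (span {φ r})`. [folklore] -/
theorem span_singleton_le_comap_span {R' T' : Type*} [CommRing R'] [CommRing T'] (φ : R' →+* T')
    (r : R') : Ideal.span {r} ≤ (Ideal.span {φ r}).comap φ :=
  (Ideal.span_singleton_le_iff_mem _).mpr (Ideal.mem_comap.mpr (Ideal.mem_span_singleton_self _))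

/-- **Quotients modulo `r` along a pushout**: if `R/rR → T/rT` is bijective then so is
`C/rC → C''/rC''` for the pushout `C'' = C ⊗_R T`. (Surjective: `c ⊗ t = c ⊗ (ρ + r t') ∈ C + rC''`;
injective: the ring map `C'' = C ⊗_R T → C/rC ⊗ … = C/rC` induced by `T → T/rT ≅ R/rR → C/rC`.)
[cite: StacksProject, Tag 088B (proof: "`B → B^∧` induces an equivalence … annihilated by `Jⁿ`")] -/
theorem quotient_bijective_of_isPushout (r : R)
    (hT : Function.Bijective (Ideal.quotientMap (I := Ideal.span {r}) (Ideal.span {algebraMap R T r})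
      (algebraMap R T) (span_singleton_le_comap_span _ r))) :
    Function.Bijective (Ideal.quotientMap (I := Ideal.span {algebraMap R C r})
      (Ideal.span {algebraMap C C'' (algebraMap R C r)})
      (algebraMap C C'') (span_singleton_le_comap_span _ _)) := by
  set rC : C := algebraMap R C r with hrC
  set rT : T := algebraMap R T r with hrT
  set rC'' : C'' := algebraMap C C'' rC with hrC''
  have hrC''T : algebraMap T C'' rT = rC'' := by
    rw [hrT, hrC'', hrC, ← IsScalarTower.algebraMap_apply, ← IsScalarTower.algebraMap_apply]
  refine ⟨fun x y hxy => ?_, fun z => ?_⟩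
  · -- injectivity: a ring map `λ : C'' → C/rC` with `λ ∘ (C → C'') = proj`
    let θ₁ : T →ₐ[R] T ⧸ Ideal.span {rT} := Ideal.Quotient.mkₐ R _
    let θ₂ : (R ⧸ Ideal.span {r}) ≃ₐ[R] (T ⧸ Ideal.span {rT}) :=
      AlgEquiv.ofBijective (Ideal.quotientMapₐ (I := Ideal.span {r}) (Ideal.span {rT})
        (Algebra.ofId R T) (span_singleton_le_comap_span (algebraMap R T) r)) hT
    let θ₃ : (R ⧸ Ideal.span {r}) →ₐ[R] (C ⧸ Ideal.span {rC}) :=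
      Ideal.quotientMapₐ (I := Ideal.span {r}) (Ideal.span {rC}) (Algebra.ofId R C)
        (span_singleton_le_comap_span (algebraMap R C) r)
    let g : T →ₐ[R] C ⧸ Ideal.span {rC} := θ₃.comp (θ₂.symm.toAlgHom.comp θ₁)
    let lam : C'' →ₐ[R] C ⧸ Ideal.span {rC} :=
      Algebra.pushoutDesc C'' (Ideal.Quotient.mkₐ R (Ideal.span {rC})) g fun _ _ => mul_comm _ _
    have hlam : ∀ c : C, lam (algebraMap C C'' c) = Ideal.Quotient.mk (Ideal.span {rC}) c :=
      fun c => Algebra.pushoutDesc_left C'' _ g _ c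
    have hlamr : lam rC'' = 0 := by
      rw [hrC'', hlam, Ideal.Quotient.eq_zero_iff_mem]
      exact Ideal.mem_span_singleton_self _
    obtain ⟨x, rfl⟩ := Ideal.Quotient.mk_surjective x
    obtain ⟨y, rfl⟩ := Ideal.Quotient.mk_surjective y
    rw [Ideal.quotientMap_mk, Ideal.quotientMap_mk, Ideal.Quotient.eq, Ideal.mem_span_singleton] at hxy
    obtain ⟨w, hw⟩ := hxy
    have h1 : lam (algebraMap C C'' x - algebraMap C C'' y) = lam (rC'' * w) := by rw [hw]
    rwa [map_sub, hlam, hlam, map_mul, hlamr, zero_mul, sub_eq_zero] at h1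
  · -- surjectivity: `c ⊗ t ≡ c ⊗ ρ = (ρ c) ⊗ 1 (mod r)`
    have key : ∀ y : C ⊗[R] T, ∃ c : C,
        Algebra.IsPushout.equiv R C T C'' y - algebraMap C C'' c ∈ Ideal.span {rC''} := by
      intro y
      induction y using TensorProduct.induction_on with
      | zero => exact ⟨0, by rw [map_zero, map_zero, sub_zero]; exact zero_mem _⟩
      | tmul c t =>
        obtain ⟨ρ', hρ⟩ := hT.2 (Ideal.Quotient.mk _ t)
        obtain ⟨ρ, rfl⟩ := Ideal.Quotient.mk_surjective ρ'
        rw [Ideal.quotientMap_mk, Ideal.Quotient.eq, Ideal.mem_span_singleton] at hρ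
        obtain ⟨t', ht'⟩ := hρ
        refine ⟨ρ • c, ?_⟩
        rw [Algebra.IsPushout.equiv_tmul, Ideal.mem_span_singleton]
        refine ⟨-(algebraMap C C'' c * algebraMap T C'' t'), ?_⟩
        have ht : t = algebraMap R T ρ - rT * t' := by rw [← ht', sub_sub_cancel]
        rw [ht, map_sub, map_mul, hrC''T, Algebra.smul_def, map_mul,
          ← IsScalarTower.algebraMap_apply R T C'' ρ, ← IsScalarTower.algebraMap_apply R C C'' ρ]
        ring
      | add y y' hy hy' =>
        obtain ⟨c, hc⟩ := hy
        obtain ⟨c', hc'⟩ := hy'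
        refine ⟨c + c', ?_⟩
        rw [map_add, map_add]
        convert add_mem hc hc' using 1
        ring
    obtain ⟨z, rfl⟩ := Ideal.Quotient.mk_surjective z
    obtain ⟨y, rfl⟩ := (Algebra.IsPushout.equiv R C T C'').surjective z
    obtain ⟨c, hc⟩ := key y
    refine ⟨Ideal.Quotient.mk _ c, ?_⟩
    rw [Ideal.quotientMap_mk, Ideal.Quotient.eq]
    rw [← neg_mem_iff, neg_sub] at hc
    exact hc

end Algebra

/-! ### The affine charts of a base change -/

section Chart

variable {P S S' : Scheme.{u}} (q : P ⟶ S) (s : S' ⟶ S) [IsAffine S] [IsAffine S']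
  {V₀ : P.Opens} (hV₀ : IsAffineOpen V₀)

include hV₀ in
/-- **`pr⁻¹V₀` is affine** (`pr : P ×_S S' → P` is affine, a base change of the affine `s`).
[cite: StacksProject, Tag 01JS] -/
theorem isAffineOpen_preimage_pullback_fst_of_isAffine : IsAffineOpen (pullback.fst q s ⁻¹ᵁ V₀) :=
  haveI : IsAffineHom (pullback.fst q s) := MorphismProperty.pullback_fst _ _ inferInstance
  hV₀.preimage _

omit [IsAffine S] [IsAffine S'] in
/-- The chart square `pr⁻¹V₀ → V₀ → S ← S'` is cartesian. [folklore] -/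
theorem isPullback_chart :
    IsPullback (pullback.fst q s ∣_ V₀) ((pullback.fst q s ⁻¹ᵁ V₀).ι ≫ pullback.snd q s)
      (V₀.ι ≫ q) s :=
  (isPullback_morphismRestrict (pullback.fst q s) V₀).paste_vert (IsPullback.of_hasPullback q s)

include hV₀ in
/-- **`Γ(pr⁻¹V₀, 𝒪) = Γ(V₀, 𝒪) ⊗_{Γ(S)} Γ(S')`**: the coordinate rings of the chart square form a
pushout square of commutative rings (restricted-scheme form). [cite: StacksProject, Tag 01JO] -/
theorem isPushout_appTop_chart :
    IsPushout (V₀.ι ≫ q).appTop s.appTop (pullback.fst q s ∣_ V₀).appTop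
      ((pullback.fst q s ⁻¹ᵁ V₀).ι ≫ pullback.snd q s).appTop :=
  haveI : IsAffine (V₀ : Scheme.{u}) := hV₀
  isPushout_appTop_of_isPullback (isPullback_chart q s)

include hV₀ in
/-- **The same with the sections over the opens `V₀ ⊆ P`, `pr⁻¹V₀ ⊆ P ×_S S'`**:
`IsPushout (q♯ : Γ(S) → Γ(V₀)) (s♯ : Γ(S) → Γ(S')) (pr♯ : Γ(V₀) → Γ(pr⁻¹V₀)) (f'♯ : Γ(S') → Γ(pr⁻¹V₀))`.
[cite: StacksProject, Tag 01JO] -/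
theorem isPushout_chart :
    IsPushout (q.appLE ⊤ V₀ le_top) s.appTop ((pullback.fst q s).app V₀)
      ((pullback.snd q s).appLE ⊤ (pullback.fst q s ⁻¹ᵁ V₀) le_top) := by
  refine (isPushout_appTop_chart q s hV₀).of_iso (Iso.refl _) V₀.topIso (Iso.refl _)
    (pullback.fst q s ⁻¹ᵁ V₀).topIso ?_ ?_ ?_ ?_
  · rw [Iso.refl_hom, Category.id_comp, Scheme.Hom.comp_appTop, Scheme.Opens.ι_appTop,
      Scheme.Opens.topIso_hom, Category.assoc]
    change q.appLE ⊤ (V₀.ι ''ᵁ ⊤) le_top ≫ _ = _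
    rw [Scheme.Hom.appLE_map]
  · simp only [Iso.refl_hom, Category.id_comp, Category.comp_id]
  · rw [Scheme.Opens.topIso_hom, Scheme.Opens.topIso_hom, morphismRestrict_appTop, Category.assoc,
      ← Functor.map_comp, Scheme.Hom.naturality]
    exact congrArg (fun k => (pullback.fst q s).app (V₀.ι ''ᵁ ⊤) ≫ (pullback q s).presheaf.map k)
      (Quiver.Hom.unop_inj (Subsingleton.elim _ _))
  · rw [Iso.refl_hom, Category.id_comp, Scheme.Hom.comp_appTop, Scheme.Opens.ι_appTop,
      Scheme.Opens.topIso_hom, Category.assoc]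
    change (pullback.snd q s).appLE ⊤ ((pullback.fst q s ⁻¹ᵁ V₀).ι ''ᵁ ⊤) le_top ≫ _ = _
    rw [Scheme.Hom.appLE_map]

end Chart

/-! ### The affine charts of a morphism of affine schemes -/

section Restrict

variable {S S' : Scheme.{u}} (s : S' ⟶ S) [IsAffine S] [IsAffine S'] {V₀ : S.Opens}
  (hV₀ : IsAffineOpen V₀)

include hV₀ in
/-- **`Γ(s⁻¹V₀, 𝒪) = Γ(V₀, 𝒪) ⊗_{Γ(S)} Γ(S')`** for a morphism `s : S' → S` of affine schemes and an
affine open `V₀ ⊆ S`: `IsPushout (res : Γ(S) → Γ(V₀)) (s♯ : Γ(S) → Γ(S')) (s♯ : Γ(V₀) → Γ(s⁻¹V₀))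
(res : Γ(S') → Γ(s⁻¹V₀))`. [cite: StacksProject, Tag 01JO] -/
theorem isPushout_restrict :
    IsPushout (S.presheaf.map (homOfLE (le_top (a := V₀))).op) s.appTop (s.app V₀)
      (S'.presheaf.map (homOfLE (le_top (a := s ⁻¹ᵁ V₀))).op) := by
  haveI : IsAffine (V₀ : Scheme.{u}) := hV₀
  have h := isPushout_appTop_of_isPullback (isPullback_morphismRestrict s V₀)
  refine h.of_iso (Iso.refl _) V₀.topIso (Iso.refl _) (s ⁻¹ᵁ V₀).topIso ?_ ?_ ?_ ?_
  · rw [Iso.refl_hom, Category.id_comp, Scheme.Opens.ι_appTop, Scheme.Opens.topIso_hom,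
      ← Functor.map_comp]
    exact congrArg (fun k => S.presheaf.map k) (Quiver.Hom.unop_inj (Subsingleton.elim _ _))
  · simp only [Iso.refl_hom, Category.id_comp, Category.comp_id]
  · rw [Scheme.Opens.topIso_hom, Scheme.Opens.topIso_hom, morphismRestrict_appTop, Category.assoc,
      ← Functor.map_comp, Scheme.Hom.naturality]
    exact congrArg (fun k => s.app (V₀.ι ''ᵁ ⊤) ≫ S'.presheaf.map k)
      (Quiver.Hom.unop_inj (Subsingleton.elim _ _))
  · rw [Iso.refl_hom, Category.id_comp, Scheme.Opens.ι_appTop, Scheme.Opens.topIso_hom,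
      ← Functor.map_comp]
    exact congrArg (fun k => S'.presheaf.map k) (Quiver.Hom.unop_inj (Subsingleton.elim _ _))

end Restrict

end Literature.AlgebraicGeometry.Morphisms

end
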